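import Mathlib

/-!
# Rank-3 Schur pruning for realisable Gram matrices (towards obligation (M) of line `wall_bubbling`; memo ADDENDUM 4 (iii))

Crux workfile for `stmt-ValiantsHypothesis-19979` (`Theses.LacunarySymmetroid.DoorA26`), line `Cruxes/DoorA26/Lines/wall_bubbling`,
plan `Lines/wall_bubbling_B-plan.md` ADDENDUM 4.  A realisable matrix `G = ε (v vᵀ − u uᵀ − w wᵀ)` factors as `Bᵀ J B` with `B` the
`3 × 6` matrix of rows `v, u, w` and `J = diag (ε, −ε, −ε)`; hence for ANY index selections `I, C : Fin 3 → Fin 6` with `det G_II ≠ 0`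
the Schur identity `G_CC = G_CI · G_II⁻¹ · G_IC` holds: the complement block is determined by, and quadratic in, the cross block.  In the
second-level bubbling at a mixed wall `2δᵢ = δₖ + δₗ` (`I = {i,k,l}`, first-level pattern `P = Eᵢᵢ − ½(Eₖₗ+Eₗₖ)` with `P_II` invertible)
this removes the six `C × C` members from the second-level limit (ADDENDUM 4 (iii)–(iv)).
Mathlib-only; an instrument: nothing here proves (M) or `DoorA26`; VP ≠ VNP is not moved. [folklore: Schur complement of a rank-3 factorisation]
-/

namespace Summit.ValiantsHypothesis.ValiantsHypothesis.Cruxes.DoorA26.WallBubbling.SchurPruning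

open Matrix

/-- The `3 × 6` matrix with rows `v, u, w`. -/
def rows3 (v u w : Fin 6 → ℝ) : Matrix (Fin 3) (Fin 6) ℝ := Matrix.of ![v, u, w]

/-- The signature matrix `diag (ε, −ε, −ε)`. -/
noncomputable def sig (ε : ℝ) : Matrix (Fin 3) (Fin 3) ℝ := Matrix.diagonal ![ε, -ε, -ε]

/-- The factorisation `ε (v vᵀ − u uᵀ − w wᵀ) = Bᵀ J B`. [folklore] -/
theorem gram_eq_factor (ε : ℝ) (v u w : Fin 6 → ℝ) :
    ε • (vecMulVec v v - vecMulVec u u - vecMulVec w w) = (rows3 v u w)ᵀ * sig ε * rows3 v u w := by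
  ext a b
  simp [rows3, sig, Matrix.mul_apply, Fin.sum_univ_three, vecMulVec_apply, Matrix.diagonal_apply]
  ring

/-- Blocks of a `Bᵀ J B` factorisation factor through the column selections. [folklore] -/
theorem submatrix_factor (B : Matrix (Fin 3) (Fin 6) ℝ) (J : Matrix (Fin 3) (Fin 3) ℝ) (I C : Fin 3 → Fin 6) :
    (Bᵀ * J * B).submatrix C I = (B.submatrix id C)ᵀ * J * B.submatrix id I := by
  ext a b
  simp [Matrix.mul_apply, Matrix.submatrix_apply, Matrix.transpose_apply]

/-- **Rank-3 Schur pruning.**  For a realisable-shaped matrix `G = ε (v vᵀ − u uᵀ − w wᵀ)` and index selections `I, C : Fin 3 → Fin 6`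
with `det G_II ≠ 0`: `G_CC = G_CI G_II⁻¹ G_IC`. [folklore] -/
theorem schur_pruning (ε : ℝ) (v u w : Fin 6 → ℝ) (G : Matrix (Fin 6) (Fin 6) ℝ)
    (hG : G = ε • (vecMulVec v v - vecMulVec u u - vecMulVec w w)) (I C : Fin 3 → Fin 6)
    (hI : (G.submatrix I I).det ≠ 0) :
    G.submatrix C C = G.submatrix C I * (G.submatrix I I)⁻¹ * G.submatrix I C := by
  have hfac : G = (rows3 v u w)ᵀ * sig ε * rows3 v u w := by rw [hG]; exact gram_eq_factor ε v u w
  set B := rows3 v u w with hB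
  set J := sig ε with hJdef
  set BI : Matrix (Fin 3) (Fin 3) ℝ := B.submatrix id I with hBI
  set BC : Matrix (Fin 3) (Fin 3) ℝ := B.submatrix id C with hBC
  have hII : G.submatrix I I = BIᵀ * J * BI := by rw [hfac, submatrix_factor]
  have hCI : G.submatrix C I = BCᵀ * J * BI := by rw [hfac, submatrix_factor]
  have hIC : G.submatrix I C = BIᵀ * J * BC := by rw [hfac, submatrix_factor]
  have hCC : G.submatrix C C = BCᵀ * J * BC := by rw [hfac, submatrix_factor]
  -- the three square factors of `G_II` are invertible
  have hdet : BIᵀ.det * J.det * BI.det ≠ 0 := by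
    rw [← det_mul, ← det_mul, ← hII]; exact hI
  have hBIu : IsUnit BI.det := isUnit_iff_ne_zero.mpr (mul_ne_zero_iff.mp hdet).2
  have hJu : IsUnit J.det := isUnit_iff_ne_zero.mpr (mul_ne_zero_iff.mp (mul_ne_zero_iff.mp hdet).1).2
  have hBItu : IsUnit BIᵀ.det := isUnit_iff_ne_zero.mpr (mul_ne_zero_iff.mp (mul_ne_zero_iff.mp hdet).1).1
  rw [hCC, hCI, hIC, hII, Matrix.mul_inv_rev, Matrix.mul_inv_rev]
  simp only [Matrix.mul_assoc]
  rw [Matrix.mul_nonsing_inv_cancel_left _ _ hBIu, Matrix.mul_nonsing_inv_cancel_left _ _ hJu,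
    Matrix.nonsing_inv_mul_cancel_left _ _ hBItu]

/-- The same for a REALISABLE matrix in the line's sense (`∃ ε = ±1, ∃ v u w`-shape written as the Gram form): if
`G = ε (v vᵀ − u uᵀ − w wᵀ)` for some sign and vectors, every complement block is the Schur expression of the cross blocks. [folklore] -/
theorem schur_pruning' (G : Matrix (Fin 6) (Fin 6) ℝ)
    (hG : ∃ (ε : ℝ) (v u w : Fin 6 → ℝ), G = ε • (vecMulVec v v - vecMulVec u u - vecMulVec w w))
    (I C : Fin 3 → Fin 6) (hI : (G.submatrix I I).det ≠ 0) :
    G.submatrix C C = G.submatrix C I * (G.submatrix I I)⁻¹ * G.submatrix I C := by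
  obtain ⟨ε, v, u, w, h⟩ := hG
  exact schur_pruning ε v u w G h I C hI

/-! ## The second-level consequence: the complement block dies in the limit (memo ADDENDUM 4 (iii)) -/

open Filter Topology

/-- **Second-level pruning.**  Let `P` be supported on `I × I` with `P_II` invertible (the first-level pattern at a mixed wall), and let
`P + R ν` be realisable-shaped for every `ν` with `R ν → 0`.  If the rescaled corrections `(μ ν)⁻¹ • R ν` converge to `Q`, then `Q_CC = 0`:
the complement block is quadratically small (`R_CC = R_CI (P_II + R_II)⁻¹ R_IC`). [folklore] -/
theorem secondLevel_complement_vanishes (P Q : Matrix (Fin 6) (Fin 6) ℝ) (I C : Fin 3 → Fin 6)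
    (hPI : (P.submatrix I I).det ≠ 0) (hPCC : P.submatrix C C = 0) (hPCI : P.submatrix C I = 0)
    (hPIC : P.submatrix I C = 0) (R : ℕ → Matrix (Fin 6) (Fin 6) ℝ) (μ : ℕ → ℝ)
    (hreal : ∀ ν, ∃ (ε : ℝ) (v u w : Fin 6 → ℝ), P + R ν = ε • (vecMulVec v v - vecMulVec u u - vecMulVec w w))
    (hR : Tendsto R atTop (𝓝 0)) (hQ : Tendsto (fun ν => (μ ν)⁻¹ • R ν) atTop (𝓝 Q)) :
    Q.submatrix C C = 0 := by
  -- convergence of the blocks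
  have hPR : Tendsto (fun ν => P + R ν) atTop (𝓝 P) := by
    have := (tendsto_const_nhds (x := P)).add hR
    rwa [add_zero] at this
  have hII : Tendsto (fun ν => (P + R ν).submatrix I I) atTop (𝓝 (P.submatrix I I)) :=
    ((continuous_id.matrix_submatrix I I).tendsto P).comp hPR
  have hdetII : Tendsto (fun ν => ((P + R ν).submatrix I I).det) atTop (𝓝 (P.submatrix I I).det) :=
    ((continuous_id.matrix_det).tendsto _).comp hII
  have hev : ∀ᶠ ν in atTop, ((P + R ν).submatrix I I).det ≠ 0 := hdetII.eventually_ne hPI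
  -- the inverse converges
  have hinvc : ContinuousAt Ring.inverse (P.submatrix I I).det := by
    rw [Ring.inverse_eq_inv']
    exact continuousAt_inv₀ hPI
  have hX : Tendsto (fun ν => ((P + R ν).submatrix I I)⁻¹) atTop (𝓝 (P.submatrix I I)⁻¹) :=
    (continuousAt_matrix_inv _ hinvc).tendsto.comp hII
  -- the rescaled cross block converges, the other cross block tends to zero
  have hCI : Tendsto (fun ν => ((μ ν)⁻¹ • R ν).submatrix C I) atTop (𝓝 (Q.submatrix C I)) :=
    ((continuous_id.matrix_submatrix C I).tendsto Q).comp hQ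
  have hIC : Tendsto (fun ν => (R ν).submatrix I C) atTop (𝓝 0) := by
    have := ((continuous_id.matrix_submatrix I C).tendsto (0 : Matrix (Fin 6) (Fin 6) ℝ)).comp hR
    rw [id, Matrix.submatrix_zero] at this
    exact this
  have hCC : Tendsto (fun ν => ((μ ν)⁻¹ • R ν).submatrix C C) atTop (𝓝 (Q.submatrix C C)) :=
    ((continuous_id.matrix_submatrix C C).tendsto Q).comp hQ
  -- the product tends to `Q_CI * P_II⁻¹ * 0 = 0`
  have hprod : Tendsto (fun ν => ((μ ν)⁻¹ • R ν).submatrix C I * ((P + R ν).submatrix I I)⁻¹ * (R ν).submatrix I C)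
      atTop (𝓝 0) := by
    have := (hCI.mul hX).mul hIC
    simpa using this
  -- Schur: eventually the two sequences agree
  have heq : (fun ν => ((μ ν)⁻¹ • R ν).submatrix C C) =ᶠ[atTop]
      (fun ν => ((μ ν)⁻¹ • R ν).submatrix C I * ((P + R ν).submatrix I I)⁻¹ * (R ν).submatrix I C) := by
    filter_upwards [hev] with ν hν
    have hs := schur_pruning' (P + R ν) (hreal ν) I C hν
    have blk : ∀ (A B : Fin 3 → Fin 6), P.submatrix A B = 0 → (P + R ν).submatrix A B = (R ν).submatrix A B := by
      intro A B h
      ext a b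
      have := congrFun (congrFun h a) b
      simp only [Matrix.submatrix_apply, Matrix.zero_apply] at this
      simp only [Matrix.submatrix_apply, Matrix.add_apply, this, zero_add]
    rw [blk C C hPCC, blk C I hPCI, blk I C hPIC] at hs
    show ((μ ν)⁻¹ • R ν).submatrix C C = ((μ ν)⁻¹ • R ν).submatrix C I * ((P + R ν).submatrix I I)⁻¹ * (R ν).submatrix I C
    rw [Matrix.submatrix_smul]
    simp only [Pi.smul_apply]
    rw [hs, Matrix.smul_mul, Matrix.smul_mul]
  exact tendsto_nhds_unique_of_eventuallyEq hCC hprod heq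

end Summit.ValiantsHypothesis.ValiantsHypothesis.Cruxes.DoorA26.WallBubbling.SchurPruning
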